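import Summits.BirchSwinnertonDyer.BirchSwinnertonDyer.Theorems.EisensteinPrimesGoodLatticeAnacongOfEisensteinCongruence
import Literature.NumberTheory.GaloisRepresentations.ArtinRestriction
import Literature.NumberTheory.EllipticCurves.RootNumberAtkinLehnerSemistableProofs
import HarnessLib

/-!
# The placement congruences of CGLS Thm. 2.2.1 over `K` from Kriz's descent conditions (2), (3) over `ℚ`:
# `a_ℓ ≡ φ̃(ℓ)` on `N₊` / `a_ℓ ≡ φ̃(ℓ)⁻¹ℓ` on `N₋` for the ℚ-character ⟹ the `K`-Frobenius congruences of the consumer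
# `GoodLatticeAnacongOfEisensteinCongruence.anacong_conclusion_of_eisensteinCongruence`
# (cell `bsd-eis`, width seat `bsd-line-x1-p1-w2` gen 26; helper for crux 2 `GoodLatticeBDPValue`, `--supports stmt-BirchSwinnertonDyer-19032`)

WHY. The consumer of a CGLS Thm. 2.2.1-shaped congruence (p757455) is phrased, like the content stub 3a-A, over `K` with a residual
pair `(θsub, θquot)`; the tree's callers of [AN] (`KatzUnitSuppliers.katzUnitAll_of_anacong`, `OfNamedFactsSix.anQ_of_thm222_OPEN`)
instantiate it at the RESTRICTIONS `θ.restrictField K` of ℚ-Teichmüller characters on the rational line / its quotient, and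
Castella–Grossi–Lee–Skinner's / Kriz's congruence conditions `a_ℓ ≡ φ(ℓ)` (`ℓ ∣ N₊`), `a_ℓ ≡ ψ(ℓ)` (`ℓ ∣ N₋`; Kriz Def. 31 (3):
`a_ℓ ≡ ψ₂(ℓ)ℓ = φ̃(ℓ)⁻¹ℓ`) are conditions on the ℚ-characters. This file transports them:
* §1 `hasFrobCharpolyAt_restrictField_of_inertiaDeg_eq_one` — rank one, `f(w|u) = 1`: `θ(Frob_u) = a ⟹ θ|_{Γ_K}(Frob_w) = a`
  (tree `FramedGaloisRep.exists_restrictField_apply_eq_pow`).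
* §2 `placement_plus_of_kriz` — (2) for `θ` at a multiplicative `ℓ ∣ N_E` ⟹ `θ|_K` has a Frobenius value at `w ∋ ℓ` congruent to
  `a_ℓ = ±1` (`LFunction_apply_primesEquiv_of_hasSplitMultiplicativeReductionAt` / `…_of_not_split`);
  `placement_minus_of_kriz` — (3) for `θquot` ⟹ `θsub|_K(Frob_w) ≡ a_ℓ`, by the residual pair's Frobenius scalars `{(εℓ, ε), (ε, εℓ)}`
  (-w2 g23/g24 `residualPair_frob_scalars_of_hasMultiplicativeReductionAtPrime'`).

HONEST FRAMING: helper theorems (0 definitions, 0 named facts, 0 sorry); closes no stub; no summit statement / crux / BSD / theorem of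
CGLS or Kriz is proved here. References: [Kriz2016] Def. 31 (2)(3), Thm. 34 (2)(3); [CastellaGrossiLeeSkinner2022] Thm. 2.2.1;
[SerreAbelianLadic1968] Ch. I §2.1; [SilvermanAEC2009] §C.16; [GreenbergVatsal2000] §2 pp. 14–15.
-/

set_option autoImplicit false
set_option linter.dupNamespace false

noncomputable section

open scoped Classical

open WeierstrassCurve NumberField IsDedekindDomain Field PowerSeries
  Literature.NumberTheory.EllipticCurves Literature.NumberTheory.EllipticCurves.Rank1Residual
  Literature.NumberTheory.GaloisRepresentations
  Literature.NumberTheory.EllipticCurves.GreenbergSelmer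
  Literature.NumberTheory.EllipticCurves.KellerYin2024
  Summit.BirchSwinnertonDyer.Rank1Residual.X11b.Halves

namespace Summit.BirchSwinnertonDyer.BirchSwinnertonDyer.Theorems.GoodLatticeAnacongPlacementOfKriz

variable {p : ℕ} [hp : Fact p.Prime] {S : Set (PadicAlgCl p)}

/-! ## §1 Restriction `ℚ → K` of a rank-one character at a degree-one place -/

section Restrict

variable {K : Type} [Field K] [NumberField K]

/-- **Frobenius value under restriction at a degree-one place (rank one).** If `θ : Γ_ℚ → GL₁(𝒪)` is unramified at the place
`u` of `ℚ` below the place `w` of `K` with `f(w|u) = 1` and `θ(Frob_u) = a`, then `θ|_{Γ_K}(Frob_w) = a`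
(`Frob_w ↦ Frob_u^{f(w|u)}` modulo inertia, the tree's `FramedGaloisRep.exists_restrictField_apply_eq_pow`).
[cite: SerreAbelianLadic1968, Ch. I §2.1] -/
theorem hasFrobCharpolyAt_restrictField_of_inertiaDeg_eq_one {θ : FramedGaloisRep ℚ (padicCoeffIntegers S) 1}
    {u : HeightOneSpectrum (𝓞 ℚ)} {w : HeightOneSpectrum (𝓞 K)} (hw : w.asIdeal.under (𝓞 ℚ) = u.asIdeal)
    (hθ : θ.IsUnramifiedAt u) (hf : w.asIdeal.inertiaDeg (𝓞 ℚ) = 1) {a : padicCoeffIntegers S}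
    (ha : θ.HasFrobCharpolyAt u (Polynomial.X - Polynomial.C a)) :
    (θ.restrictField K).HasFrobCharpolyAt w (Polynomial.X - Polynomial.C a) := by
  intro 𝔔 h𝔔 τ hτ
  obtain ⟨𝔓, h𝔓, φ, hφ, heq⟩ := θ.exists_restrictField_apply_eq_pow hw hθ h𝔔 hτ
  rw [hf, pow_one] at heq
  have h := ha 𝔓 h𝔓 φ hφ
  unfold FramedRep.charpoly at h ⊢
  rw [heq]
  exact h

end Restrict

/-! ## §2 The placement congruences of the content stub's consumer from Kriz's conditions (2), (3) over `ℚ` -/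

section Placement

variable (W : WeierstrassCurve ℚ) [W.IsElliptic] [W.IsGloballyMinimal] (K : Type) [Field K] [NumberField K]

omit [W.IsElliptic] [W.IsGloballyMinimal] in
/-- **(2) over `ℚ` ⟹ the consumer's `hplus` over `K`.** At a multiplicative `ℓ ∣ N_E` with a place `w ∋ ℓ` of `K` of residue
degree one (Heegner), if `θ : Γ_ℚ → GL₁(𝒪)` is unramified at `ℓ` and `a_ℓ(E) ≡ θ(Frob_ℓ) (mod 𝔭)` (Kriz Def. 31 (2): `ℓ ∣ N₊`), then
`θ|_{Γ_K}` has a Frobenius value at `w` congruent to `a_ℓ = ±1` (the split sign). [cite: Kriz2016, Def. 31 (2), Thm. 34 (3)]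
[cite: CastellaGrossiLeeSkinner2022, Thm. 2.2.1 (a_ℓ ≡ φ(ℓ) for ℓ ∣ N₊)] [cite: SilvermanAEC2009, §C.16 (L_v(T) = 1 ∓ T)] -/
theorem placement_plus_of_kriz (hK : IsImaginaryQuadratic K) (hH : SatisfiesHeegnerHypothesis (W.conductorNorm ℤ) K)
    {θ : FramedGaloisRep ℚ (padicCoeffIntegers S) 1} {ℓ : ℕ} (hℓN : ℓ ∈ (W.conductorNorm ℤ).primeFactors)
    {w : HeightOneSpectrum (𝓞 K)} (hw : ((ℓ : ℕ) : 𝓞 K) ∈ w.asIdeal)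
    (hmult : W.HasMultiplicativeReductionAt (w.under (𝓞 ℚ)))
    (h2 : ∀ u : HeightOneSpectrum (𝓞 ℚ), ((ℓ : ℕ) : 𝓞 ℚ) ∈ u.asIdeal → θ.IsUnramifiedAt u ∧
      ∀ a : padicCoeffIntegers S, θ.HasFrobCharpolyAt u (Polynomial.X - Polynomial.C a) →
        ‖((W.LFunction ℓ : ℤ) : PadicAlgCl p) - (a : PadicAlgCl p)‖ < 1) :
    ∃ a : padicCoeffIntegers S, (θ.restrictField K).HasFrobCharpolyAt w (Polynomial.X - Polynomial.C a) ∧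
      ‖(a : PadicAlgCl p) -
        (if W.HasSplitMultiplicativeReductionAt (w.under (𝓞 ℚ)) then (1 : PadicAlgCl p) else -1)‖ < 1 := by
  have hℓ : ℓ.Prime := Nat.prime_of_mem_primeFactors hℓN
  haveI hℓfact : Fact ℓ.Prime := ⟨hℓ⟩
  have hℓdvd : ℓ ∣ W.conductorNorm ℤ := Nat.dvd_of_mem_primeFactors hℓN
  set u := w.under (𝓞 ℚ) with hu
  have hℓu : ((ℓ : ℕ) : 𝓞 ℚ) ∈ u.asIdeal := by
    change ((ℓ : ℕ) : 𝓞 ℚ) ∈ w.asIdeal.comap (algebraMap (𝓞 ℚ) (𝓞 K))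
    rw [Ideal.mem_comap, map_natCast]; exact hw
  have hvℓ : ((Rat.HeightOneSpectrum.primesEquiv u : Nat.Primes) : ℕ) = ℓ :=
    Rat.HeightOneSpectrum.primesEquiv_eq_of_natCast_mem _ hℓ hℓu
  obtain ⟨hunr, hcong⟩ := h2 u hℓu
  obtain ⟨-, hf⟩ := Summit.BirchSwinnertonDyer.Rank1Residual.X11b.degreeOne_of_splitsIn hK.1 (hH ℓ hℓ hℓdvd) hw
  -- a Frobenius value of `θ` at `u`
  obtain ⟨𝔓, h𝔓⟩ := HeightOneSpectrum.primesAbove_nonempty u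
  obtain ⟨σ₀, hσ₀⟩ := HeightOneSpectrum.exists_isArithFrobAt_of_mem_primesAbove_holds h𝔓
  have ha := GoodLatticeAnacongEulerCompMultiplicative.hasFrobCharpolyAt_entry hunr h𝔓 hσ₀
  refine ⟨KellerYin2024.entry S θ σ₀, hasFrobCharpolyAt_restrictField_of_inertiaDeg_eq_one (K := K) rfl hunr hf ha, ?_⟩
  -- `a_ℓ = ±1`
  have haℓ : ((W.LFunction ℓ : ℤ) : PadicAlgCl p) =
      (if W.HasSplitMultiplicativeReductionAt u then (1 : PadicAlgCl p) else -1) := by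
    by_cases hsp : W.HasSplitMultiplicativeReductionAt u
    · rw [if_pos hsp, ← hvℓ, W.LFunction_apply_primesEquiv_of_hasSplitMultiplicativeReductionAt hsp, Int.cast_one]
    · rw [if_neg hsp, ← hvℓ, W.LFunction_apply_primesEquiv_of_hasMultiplicativeReductionAt_of_not_split hmult hsp,
        Int.cast_neg, Int.cast_one]
  rw [← haℓ, norm_sub_rev]
  exact hcong _ ha

/-- **(3) over `ℚ` ⟹ the consumer's `hminus` over `K`.** At the binders of the content stub 3a-A with ℚ-Teichmüller data
(`θsub`, `θquot` Teichmüller lifts on a rational line `Φ` and on `E[p]/Φ`), a multiplicative `ℓ ∣ N_E` (`ℓ ≠ p`), a place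
`w ∋ ℓ` of `K` (Heegner, degree one): if `θquot` is unramified at `ℓ` and `a_ℓ(E) ≡ θquot(Frob_ℓ)⁻¹·ℓ (mod 𝔭)` (Kriz Def. 31 (3):
`ℓ ∣ N₋`, `ψ₂ = ψ₁⁻¹`), then `θsub|_{Γ_K}` has a Frobenius value at `w` congruent to `a_ℓ = ±1` — CGLS's form «`a_ℓ ≡ ψ(ℓ)`» of the
`N₋`-condition — by the residual pair's scalars `{(εℓ, ε), (ε, εℓ)}` at `w` (-w2 g23/g24
`residualPair_frob_scalars_of_hasMultiplicativeReductionAtPrime'`). [cite: Kriz2016, Def. 31 (3), Thm. 34 (2)(3)]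
[cite: CastellaGrossiLeeSkinner2022, Thm. 2.2.1 (a_ℓ ≡ ψ(ℓ) for ℓ ∣ N₋)] [cite: GreenbergVatsal2000, §2 pp. 14–15] -/
theorem placement_minus_of_kriz (hp2 : 2 < p) (hgood : Good W p) (hred : Red W p) (hanom : Anom W p)
    (hlat : ∀ Φ : AddSubgroup (geomTorsion W (p : ℤ)), IsRationalLine W p Φ → ¬ LineUnramifiedAt W p Φ)
    (hK : IsImaginaryQuadratic K) (hH : SatisfiesHeegnerHypothesis (W.conductorNorm ℤ) K)
    (hHp : SatisfiesHeegnerHypothesis p K)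
    {θsub θquot : FramedGaloisRep ℚ (padicCoeffIntegers S) 1}
    (hpairK : IsResidualPairOver (W.baseChange K) p (θsub.restrictField K) (θquot.restrictField K))
    {ℓ : ℕ} (hℓN : ℓ ∈ (W.conductorNorm ℤ).primeFactors)
    {w : HeightOneSpectrum (𝓞 K)} (hw : ((ℓ : ℕ) : 𝓞 K) ∈ w.asIdeal)
    (hmult : W.HasMultiplicativeReductionAt (w.under (𝓞 ℚ)))
    (h3 : ∀ u : HeightOneSpectrum (𝓞 ℚ), ((ℓ : ℕ) : 𝓞 ℚ) ∈ u.asIdeal → θquot.IsUnramifiedAt u ∧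
      ∀ a : padicCoeffIntegers S, θquot.HasFrobCharpolyAt u (Polynomial.X - Polynomial.C a) →
        ‖((W.LFunction ℓ : ℤ) : PadicAlgCl p) - (a : PadicAlgCl p)⁻¹ * (ℓ : PadicAlgCl p)‖ < 1) :
    ∃ a : padicCoeffIntegers S, (θsub.restrictField K).HasFrobCharpolyAt w (Polynomial.X - Polynomial.C a) ∧
      ‖(a : PadicAlgCl p) -
        (if W.HasSplitMultiplicativeReductionAt (w.under (𝓞 ℚ)) then (1 : PadicAlgCl p) else -1)‖ < 1 := by
  have hpp := hp.out
  have hℓ : ℓ.Prime := Nat.prime_of_mem_primeFactors hℓN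
  haveI hℓfact : Fact ℓ.Prime := ⟨hℓ⟩
  have hℓdvd : ℓ ∣ W.conductorNorm ℤ := Nat.dvd_of_mem_primeFactors hℓN
  have hpN : ¬ p ∣ W.conductorNorm ℤ := not_dvd_conductorNorm_of_hasGoodReductionAtPrime W hgood
  have hℓp : ℓ ≠ p := fun h' ↦ hpN (h' ▸ hℓdvd)
  set u := w.under (𝓞 ℚ) with hu
  have hℓu : ((ℓ : ℕ) : 𝓞 ℚ) ∈ u.asIdeal := by
    change ((ℓ : ℕ) : 𝓞 ℚ) ∈ w.asIdeal.comap (algebraMap (𝓞 ℚ) (𝓞 K))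
    rw [Ideal.mem_comap, map_natCast]; exact hw
  have hvℓ : ((Rat.HeightOneSpectrum.primesEquiv u : Nat.Primes) : ℕ) = ℓ :=
    Rat.HeightOneSpectrum.primesEquiv_eq_of_natCast_mem _ hℓ hℓu
  have hmultℓ : W.HasMultiplicativeReductionAtPrime ℓ := by
    have key : ∀ (q : ℕ) (hq' : Fact q.Prime), q = ℓ →
        (haveI := hq'; W.HasMultiplicativeReductionAtPrime q) → W.HasMultiplicativeReductionAtPrime ℓ := by
      rintro q hq' rfl h''; exact h''
    exact key _ _ hvℓ ((W.hasMultiplicativeReductionAtPrime_iff_hasMultiplicativeReductionAt_ringOfIntegers u).mpr hmult)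
  have hsplit_iff : W.HasSplitMultiplicativeReductionAtPrime ℓ ↔ W.HasSplitMultiplicativeReductionAt u := by
    have key : ∀ (q : ℕ) (hq' : Fact q.Prime), q = ℓ →
        ((haveI := hq'; W.HasSplitMultiplicativeReductionAtPrime q) ↔ W.HasSplitMultiplicativeReductionAtPrime ℓ) := by
      rintro q hq' rfl; exact Iff.rfl
    rw [← key _ _ hvℓ]
    exact WeierstrassCurve.hasSplitMultiplicativeReductionAtPrime_iff_hasSplitMultiplicativeReductionAt W u
  obtain ⟨hunr, hcong⟩ := h3 u hℓu
  obtain ⟨he, hf⟩ := Summit.BirchSwinnertonDyer.Rank1Residual.X11b.degreeOne_of_splitsIn hK.1 (hH ℓ hℓ hℓdvd) hw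
  -- a Frobenius above `w`, the scalars of the `K`-pair, and the transported value of `θquot`
  obtain ⟨𝔓, h𝔓⟩ := HeightOneSpectrum.primesAbove_nonempty w
  obtain ⟨σ₀, hσ₀⟩ := HeightOneSpectrum.exists_isArithFrobAt_of_mem_primesAbove_holds h𝔓
  obtain ⟨hunr_sub, hunr_quot⟩ :=
    ResidualPairUnramifiedAtMultiplicative.isUnramifiedAt_baseChange_of_hasMultiplicativeReductionAtPrime W hpairK hℓp
      hmultℓ hw
  obtain ⟨aK, bK, haK, hbK, hsplit, hns⟩ :=
    GoodLatticeResidualPairScalarsAtMultiplicativeAll.residualPair_frob_scalars_of_hasMultiplicativeReductionAtPrime' W K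
      hp2 hred hanom hlat hK hHp hpairK hℓp hmultℓ hw hf h𝔓 hσ₀
  -- `θquot|_K(σ₀) = θquot(Frob_u)` for a Frobenius of `ℚ` at `u`: transport the `ℚ`-value
  obtain ⟨𝔓u, h𝔓u⟩ := HeightOneSpectrum.primesAbove_nonempty u
  obtain ⟨σu, hσu⟩ := HeightOneSpectrum.exists_isArithFrobAt_of_mem_primesAbove_holds h𝔓u
  have hau := GoodLatticeAnacongEulerCompMultiplicative.hasFrobCharpolyAt_entry hunr h𝔓u hσu
  set a : padicCoeffIntegers S := KellerYin2024.entry S θquot σu with ha_def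
  have haK' : (θquot.restrictField K).HasFrobCharpolyAt w (Polynomial.X - Polynomial.C a) :=
    hasFrobCharpolyAt_restrictField_of_inertiaDeg_eq_one (K := K) rfl hunr hf hau
  have hentry : KellerYin2024.entry S (θquot.restrictField K) σ₀ = a := by
    have h1 := GoodLatticeAnacongEulerCompMultiplicative.hasFrobCharpolyAt_entry hunr_quot h𝔓 hσ₀
    have h2 := FramedGaloisRep.HasFrobCharpolyAt.unique h1 haK'
    rwa [sub_right_inj, Polynomial.C_inj] at h2
  rw [hentry] at hbK
  -- `ε·bK ≡ ℓ (mod p)` from `a_ℓ ≡ a⁻¹ ℓ`, `a ≡ bK`, `a_ℓ = ε`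
  have hcong' := hcong a hau
  have hε : ((W.LFunction ℓ : ℤ) : PadicAlgCl p) =
      (if W.HasSplitMultiplicativeReductionAt u then (1 : PadicAlgCl p) else -1) := by
    by_cases hsp : W.HasSplitMultiplicativeReductionAt u
    · rw [if_pos hsp, ← hvℓ, W.LFunction_apply_primesEquiv_of_hasSplitMultiplicativeReductionAt hsp, Int.cast_one]
    · rw [if_neg hsp, ← hvℓ, W.LFunction_apply_primesEquiv_of_hasMultiplicativeReductionAt_of_not_split hmult hsp,
        Int.cast_neg, Int.cast_one]
  -- arithmetic mod `p`
  have hℓ0 : (ℓ : ZMod p) ≠ 0 := by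
    rw [Ne, ZMod.natCast_eq_zero_iff]
    exact fun h' ↦ hℓp ((Nat.prime_dvd_prime_iff_eq hpp hℓ).mp h').symm
  have h2ne : (2 : ZMod p) ≠ 0 := by
    intro h2
    have h2' : ((2 : ℕ) : ZMod p) = 0 := by exact_mod_cast h2
    rw [ZMod.natCast_eq_zero_iff] at h2'
    have := (Nat.prime_dvd_prime_iff_eq hpp Nat.prime_two).mp h2'
    omega
  have hneg1 : ¬ ((-1 : ZMod p) = 1) := by
    intro hneg
    apply h2ne
    have : (1 : ZMod p) + 1 = 0 := by nth_rewrite 1 [← hneg]; rw [neg_add_cancel]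
    rwa [← two_mul, mul_one] at this
  -- the sign `ε' = a_ℓ ∈ {1, −1}` as an integer
  set ε' : ℤ := if W.HasSplitMultiplicativeReductionAt u then 1 else -1 with hε'
  have hεcast : (if W.HasSplitMultiplicativeReductionAt u then (1 : PadicAlgCl p) else -1) = (ε' : PadicAlgCl p) := by
    by_cases hsp : W.HasSplitMultiplicativeReductionAt u
    · rw [if_pos hsp, hε', if_pos hsp, Int.cast_one]
    · rw [if_neg hsp, hε', if_neg hsp, Int.cast_neg, Int.cast_one]
  have hεnorm : ‖(ε' : PadicAlgCl p)‖ = 1 := by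
    by_cases hsp : W.HasSplitMultiplicativeReductionAt u
    · rw [hε', if_pos hsp, Int.cast_one, norm_one]
    · rw [hε', if_neg hsp, Int.cast_neg, Int.cast_one, norm_neg, norm_one]
  rw [hε, hεcast] at hcong'
  -- `a ≠ 0` (else the congruence reads `‖ε'‖ < 1`), so `‖ε' a − ℓ‖ < 1`
  have ha0 : (a : PadicAlgCl p) ≠ 0 := by
    intro h0
    rw [h0, inv_zero, zero_mul, sub_zero, hεnorm] at hcong'
    exact lt_irrefl _ hcong'
  have hale : ‖(a : PadicAlgCl p)‖ ≤ 1 := a.2.2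
  have h1 : ‖(ε' : PadicAlgCl p) * (a : PadicAlgCl p) - (ℓ : PadicAlgCl p)‖ < 1 := by
    have e : (ε' : PadicAlgCl p) * (a : PadicAlgCl p) - (ℓ : PadicAlgCl p) =
        (a : PadicAlgCl p) * ((ε' : PadicAlgCl p) - (a : PadicAlgCl p)⁻¹ * (ℓ : PadicAlgCl p)) := by
      rw [mul_sub, ← mul_assoc, mul_inv_cancel₀ ha0, one_mul, mul_comm]
    rw [e, norm_mul]
    calc ‖(a : PadicAlgCl p)‖ * ‖(ε' : PadicAlgCl p) - (a : PadicAlgCl p)⁻¹ * (ℓ : PadicAlgCl p)‖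
        ≤ 1 * ‖(ε' : PadicAlgCl p) - (a : PadicAlgCl p)⁻¹ * (ℓ : PadicAlgCl p)‖ :=
          mul_le_mul_of_nonneg_right hale (norm_nonneg _)
      _ < 1 := by rw [one_mul]; exact hcong'
  -- `‖ε' a − ε' bK‖ < 1`, hence `ε' bK ≡ ℓ (mod p)`
  have h2 : ‖(ε' : PadicAlgCl p) * (a : PadicAlgCl p) - ((ε' * bK : ℤ) : PadicAlgCl p)‖ < 1 := by
    rw [Int.cast_mul, ← mul_sub, norm_mul, hεnorm, one_mul]
    exact hbK
  have hεbℓ : ((ε' * bK : ℤ) : ZMod p) = ((ℓ : ℤ) : ZMod p) := by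
    refine GoodLatticeAnacongOfEisensteinCongruence.intCast_zmod_eq_of_norm_sub_lt
      (x := (ε' : PadicAlgCl p) * (a : PadicAlgCl p))
      h2 ?_
    rw [Int.cast_natCast]; exact h1
  rw [Int.cast_mul, Int.cast_natCast] at hεbℓ
  -- from the dichotomy: `aK ≡ ε'`
  have haKε : (aK : ZMod p) = (ε' : ZMod p) := by
    by_cases hsp : W.HasSplitMultiplicativeReductionAt u
    · have hε1 : (ε' : ZMod p) = 1 := by rw [hε', if_pos hsp, Int.cast_one]
      rw [hε1, one_mul] at hεbℓ
      rw [hε1]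
      rcases hsplit (hsplit_iff.mpr hsp) with ⟨h1', h2'⟩ | ⟨h1', -⟩
      · -- `(aK, bK) ≡ (ℓ, 1)` and `bK ≡ ℓ`: so `ℓ ≡ 1`
        rw [h1', ← hεbℓ, h2']
      · exact h1'
    · have hε1 : (ε' : ZMod p) = -1 := by rw [hε', if_neg hsp, Int.cast_neg, Int.cast_one]
      rw [hε1, neg_one_mul] at hεbℓ
      rw [hε1]
      have hnsℓ : ¬ W.HasSplitMultiplicativeReductionAtPrime ℓ := fun h' ↦ hsp (hsplit_iff.mp h')
      rcases hns hnsℓ with ⟨h1', h2'⟩ | ⟨h1', -⟩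
      · -- `(aK, bK) ≡ (−ℓ, −1)` and `−bK ≡ ℓ`: so `ℓ ≡ 1` and `aK ≡ −1`
        have hℓ1 : (ℓ : ZMod p) = 1 := by rw [← hεbℓ, h2', neg_neg]
        rw [h1', hℓ1]
      · exact h1'
  -- the witness: `θsub|_K(σ₀)`
  refine ⟨KellerYin2024.entry S (θsub.restrictField K) σ₀,
    GoodLatticeAnacongEulerCompMultiplicative.hasFrobCharpolyAt_entry hunr_sub h𝔓 hσ₀, ?_⟩
  rw [hεcast]
  have h3' : ‖(aK : PadicAlgCl p) - (ε' : PadicAlgCl p)‖ < 1 := by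
    rw [show (aK : PadicAlgCl p) - (ε' : PadicAlgCl p) = (((aK - ε' : ℤ) : ℚ_[p]) : PadicAlgCl p) by push_cast; rfl,
      PadicAlgCl.norm_extends, Padic.norm_intCast_lt_one_iff, ← ZMod.intCast_eq_intCast_iff_dvd_sub]
    exact haKε.symm
  have e : ((KellerYin2024.entry S (θsub.restrictField K) σ₀ : padicCoeffIntegers S) : PadicAlgCl p) - (ε' : PadicAlgCl p) =
      (((KellerYin2024.entry S (θsub.restrictField K) σ₀ : padicCoeffIntegers S) : PadicAlgCl p) - (aK : PadicAlgCl p)) +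
        ((aK : PadicAlgCl p) - (ε' : PadicAlgCl p)) := by ring
  rw [e]
  exact (IsUltrametricDist.norm_add_le_max _ _).trans_lt (max_lt haK h3')

end Placement

end Summit.BirchSwinnertonDyer.BirchSwinnertonDyer.Theorems.GoodLatticeAnacongPlacementOfKriz

end
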